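import Summits.AnomalousDissipation.AnomalousDissipation.Theses.KolmogorovLiouville

/-!
# Crux `KolmogorovBlowup` (stmt-AnomalousDissipation-3019, route KolmogorovLiouville, rank 3) — birth skeleton

`Lines/birth.lean`: the COVARIANCE → QUASI-LAGRANGIAN ENERGY → COMPACTNESS skeleton of the engine crux B of
route KolmogorovLiouville. Three named stubs and the kernel-checked composition
`KolmogorovBlowup_of : stub₁ → stub₂ → stub₃ → KolmogorovBlowup` (hypotheses = the name-keyed aliases
`__Registered.stub_*`, textually the stub signatures; conclusion = the route decl
`Summit.AnomalousDissipation.AnomalousDissipation.Theses.KolmogorovLiouville.KolmogorovBlowup` BY NAME; sorries only inside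
the three `stub_*`; hypothesis-free skeleton theorem `KolmogorovBlowup_skeleton` at the end).

## The cut

The crux says: from a steadily forced Leray–Hopf family `u_j` (viscosities `ν_j → 0`) carrying KOLMOGOROV FRAMES
`(t_j, ρ_j, x_j)` (sub-Taylor scale `ρ_j²/ν_j → 0`, unit oscillation floor at scale `ρ_j`, sub-ballistic
oscillation growth `≤ M R^(3+2h) ν_j² ρ_j` up to `R = 1/ρ_j`, dissipation profile `D`) extract a KOLMOGOROV STATE:
an eternal pressure-free energy-class weak solution of unforced unit-viscosity Navier–Stokes on `ℝ × ℝ³` with the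
same growth exponent and unit oscillation on `Q_1`. The line is the classical blow-up scheme, cut at its two seams:

* `stub_localUnitsCovariance` (RESCALE + FREE FALL; true, size M–L, provable now). For ONE solution and ONE frame,
  the field in LOCAL UNITS and PATH COORDINATES,
  `V(s, y) = (ρ/ν) • (U(τ, x(τ) + ρ y) − x′(τ))`, `τ = t₀ + ρ² s/ν`, `U = lift u`,
  is a pressure-free weak solution of UNIT-viscosity Navier–Stokes on the local slab `|s| < (1/ρ)²` (which lies
  inside lab times `τ > 0` because `t₀ ≥ 1/ν`) against div-free tests, with a continuous force `g` whose spatial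
  OSCILLATION on `Q_R` is `≤ C_f (ρ²/ν)² R` (the frame acceleration `x″` and the mean force `f(x(τ))` are
  spatially constant, hence invisible to compactly supported div-free tests; only `‖∇f‖_∞`-Lipschitz oscillation
  of `(ρ³/ν²) f(x(τ) + ρ y)` remains), is weakly div-free, has a weak spatial gradient with `∫∫_(Q_R) |∇V|² ≤ D(R)`,
  and its oscillations obey `≤ M R^(3+2h)` on `B_R`, a.e. `|s| ≤ R²`, `1 ≤ R ≤ 1/ρ`, and `≥ 1` on `Q_1` — the
  crux's three frame clauses after the parabolic change of variables (length `ρ`, time `ρ²/ν`, velocity `ν/ρ`).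
  Leans on: route supports `TorusLiftWeakForm` (stmt-3023) and `FreeFallCovariance` (stmt-3022) in spirit,
  `Literature.Analysis.FluidPDE.SpaceTimeRescaling` / `SuitableWeakRescaling` (`stRescale`),
  `KNSSRegularityGalilean` (`galileanShift`), lintegral change of variables under affine maps (Mathlib).
* `stub_quasiLagrangianEnergy` (the FRAME ENERGY BOUND — the line's REPAIR POINT, see below). For crux data, the
  local fields `V_j` are bounded in `L^∞_s L²_y(Q_R)` uniformly in `j`: `∫_(B_R) |V_j(s)|² ≤ E(R)` for a.e.
  `|s| ≤ R²`, `1 ≤ R ≤ 1/ρ_j`; in lab units `∫_(B_(Rρ_j)(x_j(τ))) |U_j(τ) − x_j′(τ)|² ≤ E(R) ν_j² ρ_j` — the frame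
  velocity matches the local fluid velocity to within the local velocity unit `ν_j/ρ_j`, scale by scale
  ("quasi-Lagrangian frames", Belinicher–L'vov).
* `stub_compactnessToKolmogorovState` (the ENGINE; size XL, the hardest genuine stub). Any sequence of fields `V_j`
  with the local clauses of stub 1 on slabs `|s| < L_j²`, `L_j → ∞`, force oscillation moduli `δ_j → 0`, AND the
  `j`-uniform local energy bound of stub 2, yields a Kolmogorov state of exponent `h` (the crux's conclusion
  verbatim). Proof plan: `m_j(s) := ⨍_(B_1) V_j(s)` is bounded (stub-2 clause) but has NO time regularity (frame
  acceleration is a gradient, invisible); `w_j := V_j − m_j` solves NS with the bounded spatially-constant sweeping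
  drift `m_j(s)`, so `∂_s w_j` is bounded in `L²_s H⁻¹_loc` modulo harmonic-gradient (tidal) modes and Aubin–Lions
  (`CylinderAubinLions`) gives `w_j → w` in `L²_loc` strongly along a subsequence, `m_j ⇀* m` in `L^∞_loc`;
  the drift term `∫∫ w_j·(m_j·∇)ψ` converges (strong × weak-*), tidal modes of degree `k ≥ 1` on `B_R` are
  `O(M^(1/2) L_j^(h−k)) → 0` by the top-scale growth bound (this is where `h < 1` enters), the self-interaction of
  harmonic gradients is a gradient; hence `v := w + m` is an eternal pressure-free weak solution (the parasitic
  mode `m′(s)` is again invisible), unit oscillation passes to the STRONG limit of `V_j − ⨍V_j = w_j − ⨍w_j`, growth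
  and `L^∞L²/L²H¹` bounds are weakly lower semicontinuous. Leans on: `CylinderAubinLions`,
  `SuitableWeakStability` (`isSuitableWeakSolutionOn_of_tendsto` pattern), `LocalLeray*`; CKN 1982, Lin 1998,
  Kikuchi–Seregin 2007, Lemarié-Rieusset 2016, Bradshaw–Tsai 2020, BKT arXiv:2310.15142 (growth classes `λ ≤ 2`).

Composition (`KolmogorovBlowup_of`, no sorry): unpack the crux data; stub 1 at each `j` (with `t₀ = t_j`, …) and
stub 2 give, for all large `j` (those with `ρ_j ≤ 1`, eventually true since `ρ_j → 0`), the hypothesis of stub 3 for `V_j`, `L_j := 1/ρ_j`, `δ_j := C_f (ρ_j²/ν_j)²`; `L_j → ∞` is PROVED here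
from `ρ_j > 0`, `ρ_j²/ν_j → 0`, `ν_j → 0⁺` (`ρ_j² = (ρ_j²/ν_j)·ν_j → 0`, `ρ_j = √(ρ_j²) → 0⁺`, inversion), and
`δ_j → 0` from `ρ_j²/ν_j → 0`; stub 3 returns the crux's conclusion verbatim.

## Finding (for the route's re-audit / tenure planner): the DRIFT GAP, isolated as stub 2

The crux's frame clauses bound only OSCILLATIONS `∫ |U_j − ⨍U_j|²` on balls centred on the path `x_j`, for an
ARBITRARY smooth path. They therefore leave the frame drift `m_j(s) = ⨍_(B_1) V_j(s) = (ρ_j/ν_j)(⨍_(B_ρ(x_j)) U_j − x_j′)`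
completely free. For a path that is not quasi-Lagrangian — e.g. a lab-fixed point, past which Kolmogorov-scale
structure is swept at the large-scale velocity, i.e. at local speed `~ U ρ_j/ν_j ~ Re^(1/4) → ∞` (Tennekes 1975
sweeping; Belinicher–L'vov 1987 quasi-Lagrangian variables exist precisely to remove it) — the hypotheses describe a
tube swept through the fluid: each parcel is seen for local time `O(R/m_j) → 0`, no eternal object can be extracted,
and the unit floor is destroyed by weak (time-smeared) limits. No clause of the crux excludes this (all clauses are
instantaneous spatial integrals plus a dissipation budget), and re-pathing to a Lagrangian path moves the balls off
the controlled region. Hence `KolmogorovBlowup` as filed is provable only through a `j`-uniform bound on `V_j` itself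
in path coordinates — stub 2 — which is TRUE exactly for quasi-Lagrangian frames and cannot be derived from the
filed hypotheses (nor refuted without a zeroth-law family: it is irrefutable-unprovable, like crux A). Bounded (not
vanishing) drift is enough: stub 3 tolerates it (see its plan). RECOMMENDED REPAIR (planner-level, not done here —
this seat registers only): add the lab-form clause of stub 2,
`∃ E : ℝ → ℝ, ∀ j R, 1 ≤ R → R ρ_j ≤ 1 → ∀ᵐ τ ∈ [t_j ± R²ρ_j²/ν_j], ∫_(B_(Rρ_j)(x_j(τ))) ‖lift (u_j τ) y − x_j′(τ)‖² ≤ E(R) ν_j² ρ_j`,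
to the frame conjunction of `KolmogorovBlowup` (hypothesis) and of `DeepSubBallisticFrames` (conclusion) as repaired
items `…R`; then stub 2 is immediate, stubs 1 and 3 are unchanged, and crux A's bet is the physically intended one
(frames ride with the fluid).

Disproof used: none relevant — no `Disproof.lean` / `Negative/` lemma exists for this crux at registration
(`ledger crux ls stmt-AnomalousDissipation-3019`: no workfiles, 2026-08-17); negatives index: no refuted statement of
the summit concerns local-units limits, Kolmogorov frames or eternal NS solutions. Hardest stub:
`stub_compactnessToKolmogorovState` (its recorded failure mode is the crux's own why-might-fail: time-equicontinuity
of the tidal, locally-harmonic-gradient modes for `1/2 ≤ h < 1`, to be imported shell by shell from the far field);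
`stub_quasiLagrangianEnergy` is not hard but UNPROVABLE from the filed hypotheses (repair point above).
-/

-- `Summit.<Summit>.<Problem>` is the tree's mandated summit-side namespace (CONVENTIONS §2); for this
-- single-conjunct summit the two coincide, so the duplicate is deliberate.
set_option linter.dupNamespace false

noncomputable section

open scoped BigOperators InnerProductSpace
open Filter Set Topology MeasureTheory

namespace Summit.AnomalousDissipation.AnomalousDissipation.Cruxes.KolmogorovBlowup.Birth

/-- **stub 1 — local units + free fall (parabolic rescaling and generalised Galilean covariance)**
(structure; true, size M–L, provable now). For a smooth force `f` there is a constant `C` (any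
`C ≥ ‖∇(lift f)‖_∞` works) such that for every viscosity `ν > 0`, every global Leray–Hopf solution `u`
on `T³` forced by `f`, and every frame (`t₀ ≥ 1/ν`, scale `0 < ρ ≤ 1` — so that every frame window lies in
lab times `τ ≥ 0`, where Leray–Hopf slices are honest `L²` functions and ball averages are not junk; in the
crux `ρ_j → 0`, so this holds for all large `j` — smooth path `x`) satisfying the crux's
three frame clauses at this index (unit floor, growth `≤ M R^(3+2h) ν²ρ`, a weak gradient of the lift
with dissipation `≤ D(R) ν ρ`), the field in local units and path coordinates
`V s y = (ρ/ν) • (lift (u τ) (x τ + ρ • y) − deriv x τ)`, `τ = t₀ + ρ² s/ν` (characterised by an equation,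
so the formula is written once), satisfies on the local slab `|s| < (1/ρ)²`: a weak spatial gradient with
`∫_(|s|≤R²) ∫_(B_R) |∇V|² ≤ D(R)`; weak div-freeness for a.e. `s`; oscillation growth `≤ M R^(3+2h)` on
`B_R` for a.e. `|s| ≤ R²`, `1 ≤ R ≤ 1/ρ`; the unit floor on `Q_1`; and the pressure-free weak form of
UNIT-viscosity Navier–Stokes against smooth compactly supported div-free tests with a continuous force `g`
whose oscillation obeys `‖g s y − g s 0‖ ≤ C (ρ²/ν)² R` on `Q_R` (one admissible choice:
`g s y = (ρ³/ν²) • lift f (x τ + ρ • y) − (ρ³/ν²) • x″(τ)`; spatially constant parts pair to zero with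
div-free compactly supported tests, `∫ ψᵢ = ∫ div (yᵢ ψ) = 0`). Why true: NS scaling `(length ρ, time
ρ²/ν, velocity ν/ρ)` turns viscosity `ν` into `1` and the force into `(ρ³/ν²) f(x(τ) + ρ y)`; the extended
Galilean map `y ↦ x(τ) + ρ y`, `V ↦ V − (ρ/ν) x′` keeps the pressure-free weak form (acceleration is a
gradient); the three clauses and the dissipation bound are the images of the crux's lab clauses under the
affine change of variables in `∫⁻` and `⨍` (Jacobian `ρ³` in space, `ρ²/ν` in time). Leans on: stmt-3023
`TorusLiftWeakForm`, stmt-3022 `FreeFallCovariance` (method), `stRescale` (`SpaceTimeRescaling`,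
`SuitableWeakRescaling`), `galileanShift` (`KNSSRegularityGalilean`), `MeasureTheory.lintegral_map` /
`Measure.map` of affine maps, `HasWeakSpatialGradientOn` calculus. Why it might fail: it should not; the
fiddly points are the weak-gradient/measurability transport under the affine map and the periodic unfolding
behind `TorusLiftWeakForm`. -/
theorem stub_localUnitsCovariance :
    ∀ f : UnitAddTorus (Fin 3) → EuclideanSpace ℝ (Fin 3), Literature.Analysis.FunctionSpaces.Torus.IsSmooth f → ∃ C : ℝ, ∀ (h M : ℝ) (D : ℝ → ℝ) (ν t₀ ρ : ℝ) (u₀ : UnitAddTorus (Fin 3) → EuclideanSpace ℝ (Fin 3)) (u : ℝ → UnitAddTorus (Fin 3) → EuclideanSpace ℝ (Fin 3)) (x : ℝ → EuclideanSpace ℝ (Fin 3)), 0 < ν → 0 < ρ → ρ ≤ 1 → 1 / ν ≤ t₀ → ContDiff ℝ (⊤ : ℕ∞) x → Literature.Analysis.FluidPDE.Torus.IsGlobalLerayHopf ν (fun _ => f) u₀ u → ENNReal.ofReal (ν * ρ ^ 3) ≤ ∫⁻ s in Set.Icc (t₀ - 1 ^ 2 * ρ ^ 2 / ν) (t₀ +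 1 ^ 2 * ρ ^ 2 / ν), ∫⁻ y in Metric.ball (x s) (1 * ρ), ‖Literature.Analysis.FunctionSpaces.Torus.lift (u s) y - ⨍ y' in Metric.ball (x s) (1 * ρ), Literature.Analysis.FunctionSpaces.Torus.lift (u s) y'‖ₑ ^ 2 → (∀ R : ℝ, 1 ≤ R → R * ρ ≤ 1 → ∀ᵐ s : ℝ, s ∈ Set.Icc (t₀ - R ^ 2 * ρ ^ 2 / ν) (t₀ + R ^ 2 * ρ ^ 2 / ν) → ∫⁻ y in Metric.ball (x s) (R * ρ), ‖Literature.Analysis.FunctionSpaces.Torus.lift (u s) y - ⨍ y' in Metric.ball (x s) (R * ρ), Literature.Analysis.FunctionSpaces.Torus.lift (u s) y'‖ₑ ^ 2 ≤ ENNReal.ofReal (M * R ^ (3 + 2 * h) * ν ^ 2 * ρ)) → (∃ G : ℝ → EuclideanSpace ℝ (Fin 3) → EuclideanSpace ℝ (Fin 3) →L[ℝ] EuclideanSpace ℝ (Fin 3), Literature.Analysis.FluidPDE.HasWeakSpatialGradientOn (Literature.Analysis.FluidPDE.slab (EuclideanSpace ℝ (Fin 3)) (Set.Ioi 0) isOpen_Ioi)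 (fun s y => Literature.Analysis.FunctionSpaces.Torus.lift (u s) y) G ∧ ∀ R : ℝ, 1 ≤ R → R * ρ ≤ 1 → ∫⁻ s in Set.Icc (t₀ - R ^ 2 * ρ ^ 2 / ν) (t₀ + R ^ 2 * ρ ^ 2 / ν), ∫⁻ y in Metric.ball (x s) (R * ρ), ENNReal.ofReal (Literature.Analysis.FluidPDE.frobeniusNormSq (G s y)) ≤ ENNReal.ofReal (D R * ν * ρ)) → ∀ V : ℝ → EuclideanSpace ℝ (Fin 3) → EuclideanSpace ℝ (Fin 3), (∀ s y, V s y = (ρ / ν) • (Literature.Analysis.FunctionSpaces.Torus.lift (u (t₀ + ρ ^ 2 * s / ν)) (x (t₀ + ρ ^ 2 * s / ν) + ρ • y) - deriv x (t₀ + ρ ^ 2 * s / ν))) → (∃ G : ℝ → EuclideanSpace ℝ (Fin 3) → EuclideanSpace ℝ (Fin 3) →L[ℝ] EuclideanSpace ℝ (Fin 3), Literature.Analysis.FluidPDE.HasWeakSpatialGradientOn (Literature.Analysis.FluidPDE.slab (EuclideanSpace ℝ (Fin 3)) (Set.Ioo (-(1 / ρ) ^ 2) ((1 / ρ) ^ 2))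 isOpen_Ioo) V G ∧ ∀ R : ℝ, 1 ≤ R → R ≤ (1 / ρ) → ∫⁻ s in Set.Icc (-R ^ 2) (R ^ 2), ∫⁻ y in Metric.ball (0 : EuclideanSpace ℝ (Fin 3)) R, ENNReal.ofReal (Literature.Analysis.FluidPDE.frobeniusNormSq (G s y)) ≤ ENNReal.ofReal (D R)) ∧ (∀ᵐ s : ℝ, s ∈ Set.Ioo (-(1 / ρ) ^ 2) ((1 / ρ) ^ 2) → Literature.Analysis.FluidPDE.IsWeaklyDivFree (V s)) ∧ (∀ R : ℝ, 1 ≤ R → R ≤ (1 / ρ) → ∀ᵐ s : ℝ, s ∈ Set.Icc (-R ^ 2) (R ^ 2) → ∫⁻ y in Metric.ball (0 : EuclideanSpace ℝ (Fin 3)) R, ‖V s y - ⨍ y' in Metric.ball (0 : EuclideanSpace ℝ (Fin 3)) R, V s y'‖ₑ ^ 2 ≤ ENNReal.ofReal (M * R ^ (3 + 2 * h))) ∧ ((1 : ENNReal) ≤ ∫⁻ s in Set.Icc (-1 : ℝ) 1, ∫⁻ y in Metric.ball (0 : EuclideanSpace ℝ (Fin 3)) 1, ‖V s y - ⨍ y'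 in Metric.ball (0 : EuclideanSpace ℝ (Fin 3)) 1, V s y'‖ₑ ^ 2) ∧ (∃ g : ℝ → EuclideanSpace ℝ (Fin 3) → EuclideanSpace ℝ (Fin 3), Continuous (Function.uncurry g) ∧ (∀ R : ℝ, 1 ≤ R → R ≤ (1 / ρ) → ∀ s ∈ Set.Icc (-R ^ 2) (R ^ 2), ∀ y ∈ Metric.ball (0 : EuclideanSpace ℝ (Fin 3)) R, ‖g s y - g s 0‖ ≤ C * (ρ ^ 2 / ν) ^ 2 * R) ∧ ∀ ψ : ℝ → EuclideanSpace ℝ (Fin 3) → EuclideanSpace ℝ (Fin 3), Literature.Analysis.FluidPDE.IsSpaceTimeTestOn (Literature.Analysis.FluidPDE.slab (EuclideanSpace ℝ (Fin 3)) (Set.Ioo (-(1 / ρ) ^ 2) ((1 / ρ) ^ 2)) isOpen_Ioo) ψ → (∀ s, Literature.Analysis.FluidPDE.VectorCalculus.IsDivFree (ψ s)) → ∫ s, ∫ y, (inner ℝ (V s y) (Literature.Analysis.FluidPDE.timeDeriv ψ s y) + inner ℝ (V s y) (Literature.Analysis.FluidPDE.convect (V s) (ψ s) y) + inner ℝ (V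 s y) (Laplacian.laplacian (ψ s) y) + inner ℝ (g s y) (ψ s y)) = 0) := by
  sorry

/-- **stub 2 — quasi-Lagrangian frames: the `j`-uniform local energy bound in path coordinates**
(the line's REPAIR POINT; small once the frames are quasi-Lagrangian, UNPROVABLE from the filed frame
clauses otherwise — see the module docstring). For crux data there is `E : ℝ → ℝ` such that for every `j`
the local field `V_j` (characterised by its defining equation) satisfies `∫_(B_R) ‖V_j s y‖² ≤ E(R)` for
a.e. `|s| ≤ R²`, `1 ≤ R ≤ 1/ρ_j`; in lab units
`∫_(B_(Rρ_j)(x_j(τ))) ‖lift (u_j τ) y − x_j′(τ)‖² dy ≤ E(R) ν_j² ρ_j` for a.e. `|τ − t_j| ≤ R²ρ_j²/ν_j`: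
the frame velocity `x_j′` equals the fluid velocity around the frame up to the local velocity unit `ν_j/ρ_j`,
scale by scale. Given the crux's oscillation clause this is EQUIVALENT to boundedness of the drift
`m_j(s) = ⨍_(B_1) V_j(s)` (the degree-0 parasitic mode, which oscillations cannot see). Why it might fail:
it is false for every non-quasi-Lagrangian path (lab-fixed frames see Kolmogorov-scale structure swept past
at local speed `~ Re^(1/4)`, Tennekes 1975), and the crux lets the path be arbitrary; it holds for the
physically intended frames riding with the fluid (Belinicher–L'vov 1987 quasi-Lagrangian variables) and
becomes a hypothesis after the recommended repair of the A/B interface. Sources: Tennekes, J. Fluid Mech. 67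
(1975) 561; Belinicher–L'vov, Sov. Phys. JETP 66 (1987) 303; L'vov–Procaccia, Phys. Rev. E 52 (1995) 3840;
Frisch1995 §7.2 (sweeping); the route's own `FreeFallCovariance` (stmt-3022). -/
theorem stub_quasiLagrangianEnergy :
    ∀ (h M : ℝ) (D : ℝ → ℝ) (f : UnitAddTorus (Fin 3) → EuclideanSpace ℝ (Fin 3)) (ν : ℕ → ℝ) (u₀ : ℕ → UnitAddTorus (Fin 3) → EuclideanSpace ℝ (Fin 3)) (u : ℕ → ℝ → UnitAddTorus (Fin 3) → EuclideanSpace ℝ (Fin 3)) (t ρ : ℕ → ℝ) (x : ℕ → ℝ → EuclideanSpace ℝ (Fin 3)), Literature.Analysis.FunctionSpaces.Torus.IsSmooth f → Literature.Analysis.FunctionSpaces.Torus.IsDivFree f → Literature.Analysis.FunctionSpaces.Torus.HasZeroMean f → (∀ j, 0 < ν j) → Filter.Tendsto ν Filter.atTop (nhds 0) → (∀ j, Literature.Analysis.FluidPDE.Torus.IsGlobalLerayHopf (ν j) (fun _ => f) (u₀ j) (u j)) → ((∀ j, 0 < ρ j) ∧ Filter.Tendsto (fun j => ρ j ^ 2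 / ν j) Filter.atTop (nhds 0) ∧ (∀ j, 1 / ν j ≤ t j) ∧ (∀ j, ContDiff ℝ (⊤ : ℕ∞) (x j)) ∧ (∀ j, ENNReal.ofReal (ν j * ρ j ^ 3) ≤ ∫⁻ s in Set.Icc (t j - 1 ^ 2 * ρ j ^ 2 / ν j) (t j + 1 ^ 2 * ρ j ^ 2 / ν j), ∫⁻ y in Metric.ball (x j s) (1 * ρ j), ‖Literature.Analysis.FunctionSpaces.Torus.lift (u j s) y - ⨍ y' in Metric.ball (x j s) (1 * ρ j), Literature.Analysis.FunctionSpaces.Torus.lift (u j s) y'‖ₑ ^ 2) ∧ (∀ j (R : ℝ), 1 ≤ R → R * ρ j ≤ 1 → ∀ᵐ s : ℝ, s ∈ Set.Icc (t j - R ^ 2 * ρ j ^ 2 / ν j) (t j + R ^ 2 * ρ j ^ 2 / ν j) → ∫⁻ y in Metric.ball (x j s) (R * ρ j), ‖Literature.Analysis.FunctionSpaces.Torus.lift (u j s) y - ⨍ y' in Metric.ball (x j s) (R * ρ j), Literature.Analysis.FunctionSpaces.Torus.lift (u j s) y'‖ₑ ^ 2 ≤ ENNReal.ofReal (M * R ^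 (3 + 2 * h) * ν j ^ 2 * ρ j)) ∧ (∀ j, ∃ G : ℝ → EuclideanSpace ℝ (Fin 3) → EuclideanSpace ℝ (Fin 3) →L[ℝ] EuclideanSpace ℝ (Fin 3), Literature.Analysis.FluidPDE.HasWeakSpatialGradientOn (Literature.Analysis.FluidPDE.slab (EuclideanSpace ℝ (Fin 3)) (Set.Ioi 0) isOpen_Ioi) (fun s y => Literature.Analysis.FunctionSpaces.Torus.lift (u j s) y) G ∧ ∀ R : ℝ, 1 ≤ R → R * ρ j ≤ 1 → ∫⁻ s in Set.Icc (t j - R ^ 2 * ρ j ^ 2 / ν j) (t j + R ^ 2 * ρ j ^ 2 / ν j), ∫⁻ y in Metric.ball (x j s) (R * ρ j), ENNReal.ofReal (Literature.Analysis.FluidPDE.frobeniusNormSq (G s y)) ≤ ENNReal.ofReal (D R * ν j * ρ j))) → ∃ E : ℝ → ℝ, ∀ (j : ℕ) (V : ℝ → EuclideanSpace ℝ (Fin 3) → EuclideanSpace ℝ (Fin 3)), (∀ s y, V s y = (ρ j / ν j) • (Literature.Analysis.FunctionSpaces.Torus.lift (u j (t j + ρ j ^ 2 * s / ν j)) (x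 j (t j + ρ j ^ 2 * s / ν j) + ρ j • y) - deriv (x j) (t j + ρ j ^ 2 * s / ν j))) → ∀ R : ℝ, 1 ≤ R → R ≤ (1 / ρ j) → ∀ᵐ s : ℝ, s ∈ Set.Icc (-R ^ 2) (R ^ 2) → ∫⁻ y in Metric.ball (0 : EuclideanSpace ℝ (Fin 3)) R, ‖V s y‖ₑ ^ 2 ≤ ENNReal.ofReal (E R) := by
  sorry

/-- **stub 3 — drift-tolerant compactness to a Kolmogorov state** (the ENGINE; size XL, the hardest stub).
For `h < 1`, constants `M`, profiles `D, E : ℝ → ℝ`, any sequence `V_j : ℝ → ℝ³ → ℝ³` with levels `L_j → ∞`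
and force-oscillation moduli `δ_j → 0` such that, for all large `j`, `V_j`, on the slab `|s| < L_j²`, has a weak spatial
gradient with `∫∫_(Q_R) |∇V_j|² ≤ D(R)`, is weakly div-free for a.e. `s`, has oscillation growth
`≤ M R^(3+2h)` (`1 ≤ R ≤ L_j`, a.e. `|s| ≤ R²`), unit floor on `Q_1`, solves the pressure-free weak form of
unit-viscosity NS against div-free tests with a continuous force of oscillation `≤ δ_j R` on `Q_R`, AND is
bounded in `L^∞_s L²_y(Q_R)` by `E(R)` uniformly in `j`, there is a Kolmogorov state of exponent `h`: an
eternal pressure-free energy-class weak solution `v` of UNFORCED unit-viscosity NS on `ℝ × ℝ³` (the class of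
`SubBallisticLiouville`) with growth `≤ M′ R^(3+2h)` and `∫_(−1)^1 ∫_(B_1) ‖v − ⨍v‖² ≥ 1` — the crux's
conclusion verbatim. Plan (module docstring): subtract the bounded, time-rough drift `m_j(s) = ⨍_(B_1)V_j(s)`,
Aubin–Lions for `w_j = V_j − m_j` (sweeping term bounded since `m_j ∈ L^∞` is spatially constant), tidal
harmonic-gradient modes of degree `≥ 1` are `O(M^(1/2) L_j^(h−1)) → 0` by the top-scale growth bound,
self-interaction of harmonic gradients is a gradient, `m_j ⇀* m`, and `v = lim w_j + m` is again a solution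
(parasitic modes are invisible to div-free tests); the floor passes to the strong limit of `V_j − ⨍V_j`,
growth and energy/enstrophy bounds are weakly l.s.c., spatially constant parts of `g_j` pair to zero and the
rest is `O(δ_j) → 0`. Why it might fail (= the crux's recorded why-might-fail): strong `L²(Q_R)` compactness
needs time-equicontinuity of the locally-harmonic-gradient (tidal) components of `V_j|_(B_R)` induced by the
far field; local-energy theory in print stops at growth `∫_(B_R)|u|² ≲ R^λ`, `λ ≤ 2` (Bradshaw–Kukavica–Tsai,
arXiv:2310.15142 §1; Fernández-Dalgo–Lemarié-Rieusset 2021), here `λ = 3 + 2h < 5`, and the subtracted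
local pressure expansion converges only for `h < 1/2`; for `1/2 ≤ h < 1` the control must be imported shell
by shell up to `R = L_j`, where the growth bound closes it. Sources: CaffarelliKohnNirenberg1982, Lin1998,
KikuchiSeregin2007, LemarieRieusset2016, BradshawTsai2020, arXiv:2310.15142, KochNadirashviliSereginSverak2009
(blow-up/Liouville scheme), Seregin–Šverák local compactness; tree: `CylinderAubinLions`,
`SuitableWeakStability`, `LocalLeray*`. -/
theorem stub_compactnessToKolmogorovState :
    ∀ (h M : ℝ) (D E : ℝ → ℝ), h < 1 → ∀ (V : ℕ → ℝ → EuclideanSpace ℝ (Fin 3) → EuclideanSpace ℝ (Fin 3)) (L δ : ℕ → ℝ), Filter.Tendsto L Filter.atTop Filter.atTop → Filter.Tendsto δ Filter.atTop (nhds 0) → (∀ᶠ j in Filter.atTop, ((∃ G : ℝ → EuclideanSpace ℝ (Fin 3) → EuclideanSpace ℝ (Fin 3) →L[ℝ] EuclideanSpace ℝ (Fin 3), Literature.Analysis.FluidPDE.HasWeakSpatialGradientOn (Literature.Analysis.FluidPDE.slab (EuclideanSpace ℝ (Fin 3)) (Set.Ioo (-L j ^ 2) (L j ^ 2)) isOpen_Ioo)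 (V j) G ∧ ∀ R : ℝ, 1 ≤ R → R ≤ L j → ∫⁻ s in Set.Icc (-R ^ 2) (R ^ 2), ∫⁻ y in Metric.ball (0 : EuclideanSpace ℝ (Fin 3)) R, ENNReal.ofReal (Literature.Analysis.FluidPDE.frobeniusNormSq (G s y)) ≤ ENNReal.ofReal (D R)) ∧ (∀ᵐ s : ℝ, s ∈ Set.Ioo (-L j ^ 2) (L j ^ 2) → Literature.Analysis.FluidPDE.IsWeaklyDivFree (V j s)) ∧ (∀ R : ℝ, 1 ≤ R → R ≤ L j → ∀ᵐ s : ℝ, s ∈ Set.Icc (-R ^ 2) (R ^ 2) → ∫⁻ y in Metric.ball (0 : EuclideanSpace ℝ (Fin 3)) R, ‖V j s y - ⨍ y' in Metric.ball (0 : EuclideanSpace ℝ (Fin 3)) R, V j s y'‖ₑ ^ 2 ≤ ENNReal.ofReal (M * R ^ (3 + 2 * h))) ∧ ((1 : ENNReal) ≤ ∫⁻ s in Set.Icc (-1 : ℝ) 1, ∫⁻ y in Metric.ball (0 : EuclideanSpace ℝ (Fin 3)) 1, ‖V j s y - ⨍ y' in Metric.ball (0 : EuclideanSpace ℝ (Fin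 3)) 1, V j s y'‖ₑ ^ 2) ∧ (∃ g : ℝ → EuclideanSpace ℝ (Fin 3) → EuclideanSpace ℝ (Fin 3), Continuous (Function.uncurry g) ∧ (∀ R : ℝ, 1 ≤ R → R ≤ L j → ∀ s ∈ Set.Icc (-R ^ 2) (R ^ 2), ∀ y ∈ Metric.ball (0 : EuclideanSpace ℝ (Fin 3)) R, ‖g s y - g s 0‖ ≤ δ j * R) ∧ ∀ ψ : ℝ → EuclideanSpace ℝ (Fin 3) → EuclideanSpace ℝ (Fin 3), Literature.Analysis.FluidPDE.IsSpaceTimeTestOn (Literature.Analysis.FluidPDE.slab (EuclideanSpace ℝ (Fin 3)) (Set.Ioo (-L j ^ 2) (L j ^ 2)) isOpen_Ioo) ψ → (∀ s, Literature.Analysis.FluidPDE.VectorCalculus.IsDivFree (ψ s)) → ∫ s, ∫ y, (inner ℝ (V j s y) (Literature.Analysis.FluidPDE.timeDeriv ψ s y) + inner ℝ (V j s y) (Literature.Analysis.FluidPDE.convect (V j s) (ψ s) y) + inner ℝ (V j s y) (Laplacian.laplacian (ψ s) y) + inner ℝ (g s y) (ψ s y)) = 0)) ∧ (∀ R : ℝ,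 1 ≤ R → R ≤ L j → ∀ᵐ s : ℝ, s ∈ Set.Icc (-R ^ 2) (R ^ 2) → ∫⁻ y in Metric.ball (0 : EuclideanSpace ℝ (Fin 3)) R, ‖V j s y‖ₑ ^ 2 ≤ ENNReal.ofReal (E R))) → (∃ v : ℝ → EuclideanSpace ℝ (Fin 3) → EuclideanSpace ℝ (Fin 3), (MeasureTheory.AEStronglyMeasurable (Function.uncurry v) MeasureTheory.volume ∧ (∀ R : ℝ, 0 < R → ∃ C : NNReal, ∀ᵐ t : ℝ, t ∈ Set.Icc (-R ^ 2) (R ^ 2) → ∫⁻ x in Metric.ball (0 : EuclideanSpace ℝ (Fin 3)) (R), ‖v t x‖ₑ ^ 2 ≤ C) ∧ (∀ᵐ t : ℝ, Literature.Analysis.FluidPDE.IsWeaklyDivFree (v t)) ∧ (∃ G : ℝ → EuclideanSpace ℝ (Fin 3) → EuclideanSpace ℝ (Fin 3) →L[ℝ] EuclideanSpace ℝ (Fin 3), Literature.Analysis.FluidPDE.HasWeakSpatialGradientOn (Literature.Analysis.FluidPDE.slab (EuclideanSpace ℝ (Fin 3)) Set.univ isOpen_univ) v G ∧ ∀ R :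 ℝ, 0 < R → ∫⁻ z in Set.Icc (-R ^ 2) (R ^ 2) ×ˢ Metric.ball (0 : EuclideanSpace ℝ (Fin 3)) (R), ENNReal.ofReal (Literature.Analysis.FluidPDE.frobeniusNormSq (G z.1 z.2)) < ⊤) ∧ (∀ ψ : ℝ → EuclideanSpace ℝ (Fin 3) → EuclideanSpace ℝ (Fin 3), Literature.Analysis.FluidPDE.IsSpaceTimeTestOn (Literature.Analysis.FluidPDE.slab (EuclideanSpace ℝ (Fin 3)) Set.univ isOpen_univ) ψ → (∀ t, Literature.Analysis.FluidPDE.VectorCalculus.IsDivFree (ψ t)) → ∫ t, ∫ x, (inner ℝ (v t x) (Literature.Analysis.FluidPDE.timeDeriv ψ t x) + inner ℝ (v t x) (Literature.Analysis.FluidPDE.convect (v t) (ψ t) x) + inner ℝ (v t x) (Laplacian.laplacian (ψ t) x)) = 0)) ∧ (∃ M' : ℝ, (∀ R : ℝ, 1 ≤ R → ∀ᵐ t : ℝ, t ∈ Set.Icc (-R ^ 2) (R ^ 2) → ∫⁻ x in Metric.ball (0 : EuclideanSpace ℝ (Fin 3)) (R), ‖v t x - ⨍ y in Metric.ball (0 :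 EuclideanSpace ℝ (Fin 3)) (R), v t y‖ₑ ^ 2 ≤ ENNReal.ofReal (M' * R ^ (3 + 2 * h)))) ∧ ((1 : ENNReal) ≤ ∫⁻ t in Set.Icc (-1 : ℝ) 1, ∫⁻ x in Metric.ball (0 : EuclideanSpace ℝ (Fin 3)) (1), ‖v t x - ⨍ y in Metric.ball (0 : EuclideanSpace ℝ (Fin 3)) (1), v t y‖ₑ ^ 2)) := by
  sorry

/-! ## Name-keyed aliases of the three stub statements — the hypotheses of `KolmogorovBlowup_of`

The native skeleton audit (`#h21_check_skeleton`, run by `ledger skeleton check`) admits a hypothesis of the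
composing theorem only if its head constant is a registered obligation or is NAMED like a declared stub;
`__Registered.stub_X` is the statement of `stub_X` verbatim under the stub's short name (device of
`Cruxes/MirrorFloorTG/Lines/birth.lean`, `Cruxes/CyclicWindLineLoud/Lines/birth.lean`; the `__` namespace is an
implementation detail, so the audit's stub report resolves each `stub_…` to the sorried theorem above, not to its
alias). Each alias is an `abbrev`, definitionally (and textually) its stub's signature — generated from the same
source text (planner folder `gen_birth.py`). -/
namespace __Registered

/-- Alias of the statement of `stub_localUnitsCovariance` (local units + free fall), keyed by the stub name. -/
abbrev stub_localUnitsCovariance : Prop :=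
  ∀ f : UnitAddTorus (Fin 3) → EuclideanSpace ℝ (Fin 3), Literature.Analysis.FunctionSpaces.Torus.IsSmooth f → ∃ C : ℝ, ∀ (h M : ℝ) (D : ℝ → ℝ) (ν t₀ ρ : ℝ) (u₀ : UnitAddTorus (Fin 3) → EuclideanSpace ℝ (Fin 3)) (u : ℝ → UnitAddTorus (Fin 3) → EuclideanSpace ℝ (Fin 3)) (x : ℝ → EuclideanSpace ℝ (Fin 3)), 0 < ν → 0 < ρ → ρ ≤ 1 → 1 / ν ≤ t₀ → ContDiff ℝ (⊤ : ℕ∞) x → Literature.Analysis.FluidPDE.Torus.IsGlobalLerayHopf ν (fun _ => f) u₀ u → ENNReal.ofReal (ν * ρ ^ 3) ≤ ∫⁻ s in Set.Icc (t₀ - 1 ^ 2 * ρ ^ 2 / ν) (t₀ + 1 ^ 2 * ρ ^ 2 / ν), ∫⁻ y in Metric.ball (x s) (1 * ρ), ‖Literature.Analysis.FunctionSpaces.Torus.lift (u s) y - ⨍ y' in Metric.ball (x s) (1 * ρ), Literature.Analysis.FunctionSpaces.Torus.lift (u s) y'‖ₑ ^ 2 → (∀ R : ℝ, 1 ≤ R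 → R * ρ ≤ 1 → ∀ᵐ s : ℝ, s ∈ Set.Icc (t₀ - R ^ 2 * ρ ^ 2 / ν) (t₀ + R ^ 2 * ρ ^ 2 / ν) → ∫⁻ y in Metric.ball (x s) (R * ρ), ‖Literature.Analysis.FunctionSpaces.Torus.lift (u s) y - ⨍ y' in Metric.ball (x s) (R * ρ), Literature.Analysis.FunctionSpaces.Torus.lift (u s) y'‖ₑ ^ 2 ≤ ENNReal.ofReal (M * R ^ (3 + 2 * h) * ν ^ 2 * ρ)) → (∃ G : ℝ → EuclideanSpace ℝ (Fin 3) → EuclideanSpace ℝ (Fin 3) →L[ℝ] EuclideanSpace ℝ (Fin 3), Literature.Analysis.FluidPDE.HasWeakSpatialGradientOn (Literature.Analysis.FluidPDE.slab (EuclideanSpace ℝ (Fin 3)) (Set.Ioi 0) isOpen_Ioi) (fun s y => Literature.Analysis.FunctionSpaces.Torus.lift (u s) y) G ∧ ∀ R : ℝ, 1 ≤ R → R * ρ ≤ 1 → ∫⁻ s in Set.Icc (t₀ - R ^ 2 * ρ ^ 2 / ν) (t₀ + R ^ 2 * ρ ^ 2 / ν), ∫⁻ y in Metric.ball (x s) (R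 * ρ), ENNReal.ofReal (Literature.Analysis.FluidPDE.frobeniusNormSq (G s y)) ≤ ENNReal.ofReal (D R * ν * ρ)) → ∀ V : ℝ → EuclideanSpace ℝ (Fin 3) → EuclideanSpace ℝ (Fin 3), (∀ s y, V s y = (ρ / ν) • (Literature.Analysis.FunctionSpaces.Torus.lift (u (t₀ + ρ ^ 2 * s / ν)) (x (t₀ + ρ ^ 2 * s / ν) + ρ • y) - deriv x (t₀ + ρ ^ 2 * s / ν))) → (∃ G : ℝ → EuclideanSpace ℝ (Fin 3) → EuclideanSpace ℝ (Fin 3) →L[ℝ] EuclideanSpace ℝ (Fin 3), Literature.Analysis.FluidPDE.HasWeakSpatialGradientOn (Literature.Analysis.FluidPDE.slab (EuclideanSpace ℝ (Fin 3)) (Set.Ioo (-(1 / ρ) ^ 2) ((1 / ρ) ^ 2)) isOpen_Ioo) V G ∧ ∀ R : ℝ, 1 ≤ R → R ≤ (1 / ρ) → ∫⁻ s in Set.Icc (-R ^ 2) (R ^ 2), ∫⁻ y in Metric.ball (0 : EuclideanSpace ℝ (Fin 3)) R, ENNReal.ofReal (Literature.Analysis.FluidPDE.frobeniusNormSq (G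 s y)) ≤ ENNReal.ofReal (D R)) ∧ (∀ᵐ s : ℝ, s ∈ Set.Ioo (-(1 / ρ) ^ 2) ((1 / ρ) ^ 2) → Literature.Analysis.FluidPDE.IsWeaklyDivFree (V s)) ∧ (∀ R : ℝ, 1 ≤ R → R ≤ (1 / ρ) → ∀ᵐ s : ℝ, s ∈ Set.Icc (-R ^ 2) (R ^ 2) → ∫⁻ y in Metric.ball (0 : EuclideanSpace ℝ (Fin 3)) R, ‖V s y - ⨍ y' in Metric.ball (0 : EuclideanSpace ℝ (Fin 3)) R, V s y'‖ₑ ^ 2 ≤ ENNReal.ofReal (M * R ^ (3 + 2 * h))) ∧ ((1 : ENNReal) ≤ ∫⁻ s in Set.Icc (-1 : ℝ) 1, ∫⁻ y in Metric.ball (0 : EuclideanSpace ℝ (Fin 3)) 1, ‖V s y - ⨍ y' in Metric.ball (0 : EuclideanSpace ℝ (Fin 3)) 1, V s y'‖ₑ ^ 2) ∧ (∃ g : ℝ → EuclideanSpace ℝ (Fin 3) → EuclideanSpace ℝ (Fin 3), Continuous (Function.uncurry g) ∧ (∀ R : ℝ, 1 ≤ R → R ≤ (1 / ρ) → ∀ s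 ∈ Set.Icc (-R ^ 2) (R ^ 2), ∀ y ∈ Metric.ball (0 : EuclideanSpace ℝ (Fin 3)) R, ‖g s y - g s 0‖ ≤ C * (ρ ^ 2 / ν) ^ 2 * R) ∧ ∀ ψ : ℝ → EuclideanSpace ℝ (Fin 3) → EuclideanSpace ℝ (Fin 3), Literature.Analysis.FluidPDE.IsSpaceTimeTestOn (Literature.Analysis.FluidPDE.slab (EuclideanSpace ℝ (Fin 3)) (Set.Ioo (-(1 / ρ) ^ 2) ((1 / ρ) ^ 2)) isOpen_Ioo) ψ → (∀ s, Literature.Analysis.FluidPDE.VectorCalculus.IsDivFree (ψ s)) → ∫ s, ∫ y, (inner ℝ (V s y) (Literature.Analysis.FluidPDE.timeDeriv ψ s y) + inner ℝ (V s y) (Literature.Analysis.FluidPDE.convect (V s) (ψ s) y) + inner ℝ (V s y) (Laplacian.laplacian (ψ s) y) + inner ℝ (g s y) (ψ s y)) = 0)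

/-- Alias of the statement of `stub_quasiLagrangianEnergy` (frame energy bound), keyed by the stub name. -/
abbrev stub_quasiLagrangianEnergy : Prop :=
  ∀ (h M : ℝ) (D : ℝ → ℝ) (f : UnitAddTorus (Fin 3) → EuclideanSpace ℝ (Fin 3)) (ν : ℕ → ℝ) (u₀ : ℕ → UnitAddTorus (Fin 3) → EuclideanSpace ℝ (Fin 3)) (u : ℕ → ℝ → UnitAddTorus (Fin 3) → EuclideanSpace ℝ (Fin 3)) (t ρ : ℕ → ℝ) (x : ℕ → ℝ → EuclideanSpace ℝ (Fin 3)), Literature.Analysis.FunctionSpaces.Torus.IsSmooth f → Literature.Analysis.FunctionSpaces.Torus.IsDivFree f → Literature.Analysis.FunctionSpaces.Torus.HasZeroMean f → (∀ j, 0 < ν j) → Filter.Tendsto ν Filter.atTop (nhds 0) → (∀ j, Literature.Analysis.FluidPDE.Torus.IsGlobalLerayHopf (ν j) (fun _ => f) (u₀ j) (u j)) → ((∀ j, 0 < ρ j) ∧ Filter.Tendsto (fun j => ρ j ^ 2 / ν j) Filter.atTop (nhds 0) ∧ (∀ j, 1 / ν j ≤ t j) ∧ (∀ j, ContDiff ℝ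 (⊤ : ℕ∞) (x j)) ∧ (∀ j, ENNReal.ofReal (ν j * ρ j ^ 3) ≤ ∫⁻ s in Set.Icc (t j - 1 ^ 2 * ρ j ^ 2 / ν j) (t j + 1 ^ 2 * ρ j ^ 2 / ν j), ∫⁻ y in Metric.ball (x j s) (1 * ρ j), ‖Literature.Analysis.FunctionSpaces.Torus.lift (u j s) y - ⨍ y' in Metric.ball (x j s) (1 * ρ j), Literature.Analysis.FunctionSpaces.Torus.lift (u j s) y'‖ₑ ^ 2) ∧ (∀ j (R : ℝ), 1 ≤ R → R * ρ j ≤ 1 → ∀ᵐ s : ℝ, s ∈ Set.Icc (t j - R ^ 2 * ρ j ^ 2 / ν j) (t j + R ^ 2 * ρ j ^ 2 / ν j) → ∫⁻ y in Metric.ball (x j s) (R * ρ j), ‖Literature.Analysis.FunctionSpaces.Torus.lift (u j s) y - ⨍ y' in Metric.ball (x j s) (R * ρ j), Literature.Analysis.FunctionSpaces.Torus.lift (u j s) y'‖ₑ ^ 2 ≤ ENNReal.ofReal (M * R ^ (3 + 2 * h) * ν j ^ 2 * ρ j)) ∧ (∀ j, ∃ G : ℝ → EuclideanSpace ℝ (Fin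 3) → EuclideanSpace ℝ (Fin 3) →L[ℝ] EuclideanSpace ℝ (Fin 3), Literature.Analysis.FluidPDE.HasWeakSpatialGradientOn (Literature.Analysis.FluidPDE.slab (EuclideanSpace ℝ (Fin 3)) (Set.Ioi 0) isOpen_Ioi) (fun s y => Literature.Analysis.FunctionSpaces.Torus.lift (u j s) y) G ∧ ∀ R : ℝ, 1 ≤ R → R * ρ j ≤ 1 → ∫⁻ s in Set.Icc (t j - R ^ 2 * ρ j ^ 2 / ν j) (t j + R ^ 2 * ρ j ^ 2 / ν j), ∫⁻ y in Metric.ball (x j s) (R * ρ j), ENNReal.ofReal (Literature.Analysis.FluidPDE.frobeniusNormSq (G s y)) ≤ ENNReal.ofReal (D R * ν j * ρ j))) → ∃ E : ℝ → ℝ, ∀ (j : ℕ) (V : ℝ → EuclideanSpace ℝ (Fin 3) → EuclideanSpace ℝ (Fin 3)), (∀ s y, V s y = (ρ j / ν j) • (Literature.Analysis.FunctionSpaces.Torus.lift (u j (t j + ρ j ^ 2 * s / ν j)) (x j (t j + ρ j ^ 2 * s / ν j) + ρ j • y) - deriv (x j) (t j + ρ j ^ 2 * s / ν j))) → ∀ R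 : ℝ, 1 ≤ R → R ≤ (1 / ρ j) → ∀ᵐ s : ℝ, s ∈ Set.Icc (-R ^ 2) (R ^ 2) → ∫⁻ y in Metric.ball (0 : EuclideanSpace ℝ (Fin 3)) R, ‖V s y‖ₑ ^ 2 ≤ ENNReal.ofReal (E R)

/-- Alias of the statement of `stub_compactnessToKolmogorovState` (drift-tolerant compactness), keyed by the stub name. -/
abbrev stub_compactnessToKolmogorovState : Prop :=
  ∀ (h M : ℝ) (D E : ℝ → ℝ), h < 1 → ∀ (V : ℕ → ℝ → EuclideanSpace ℝ (Fin 3) → EuclideanSpace ℝ (Fin 3)) (L δ : ℕ → ℝ), Filter.Tendsto L Filter.atTop Filter.atTop → Filter.Tendsto δ Filter.atTop (nhds 0) → (∀ᶠ j in Filter.atTop, ((∃ G : ℝ → EuclideanSpace ℝ (Fin 3) → EuclideanSpace ℝ (Fin 3) →L[ℝ] EuclideanSpace ℝ (Fin 3), Literature.Analysis.FluidPDE.HasWeakSpatialGradientOn (Literature.Analysis.FluidPDE.slab (EuclideanSpace ℝ (Fin 3)) (Set.Ioo (-L j ^ 2) (L j ^ 2)) isOpen_Ioo) (V j) G ∧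 ∀ R : ℝ, 1 ≤ R → R ≤ L j → ∫⁻ s in Set.Icc (-R ^ 2) (R ^ 2), ∫⁻ y in Metric.ball (0 : EuclideanSpace ℝ (Fin 3)) R, ENNReal.ofReal (Literature.Analysis.FluidPDE.frobeniusNormSq (G s y)) ≤ ENNReal.ofReal (D R)) ∧ (∀ᵐ s : ℝ, s ∈ Set.Ioo (-L j ^ 2) (L j ^ 2) → Literature.Analysis.FluidPDE.IsWeaklyDivFree (V j s)) ∧ (∀ R : ℝ, 1 ≤ R → R ≤ L j → ∀ᵐ s : ℝ, s ∈ Set.Icc (-R ^ 2) (R ^ 2) → ∫⁻ y in Metric.ball (0 : EuclideanSpace ℝ (Fin 3)) R, ‖V j s y - ⨍ y' in Metric.ball (0 : EuclideanSpace ℝ (Fin 3)) R, V j s y'‖ₑ ^ 2 ≤ ENNReal.ofReal (M * R ^ (3 + 2 * h))) ∧ ((1 : ENNReal) ≤ ∫⁻ s in Set.Icc (-1 : ℝ) 1, ∫⁻ y in Metric.ball (0 : EuclideanSpace ℝ (Fin 3)) 1, ‖V j s y - ⨍ y' in Metric.ball (0 : EuclideanSpace ℝ (Fin 3)) 1, V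 j s y'‖ₑ ^ 2) ∧ (∃ g : ℝ → EuclideanSpace ℝ (Fin 3) → EuclideanSpace ℝ (Fin 3), Continuous (Function.uncurry g) ∧ (∀ R : ℝ, 1 ≤ R → R ≤ L j → ∀ s ∈ Set.Icc (-R ^ 2) (R ^ 2), ∀ y ∈ Metric.ball (0 : EuclideanSpace ℝ (Fin 3)) R, ‖g s y - g s 0‖ ≤ δ j * R) ∧ ∀ ψ : ℝ → EuclideanSpace ℝ (Fin 3) → EuclideanSpace ℝ (Fin 3), Literature.Analysis.FluidPDE.IsSpaceTimeTestOn (Literature.Analysis.FluidPDE.slab (EuclideanSpace ℝ (Fin 3)) (Set.Ioo (-L j ^ 2) (L j ^ 2)) isOpen_Ioo) ψ → (∀ s, Literature.Analysis.FluidPDE.VectorCalculus.IsDivFree (ψ s)) → ∫ s, ∫ y, (inner ℝ (V j s y) (Literature.Analysis.FluidPDE.timeDeriv ψ s y) + inner ℝ (V j s y) (Literature.Analysis.FluidPDE.convect (V j s) (ψ s) y) + inner ℝ (V j s y) (Laplacian.laplacian (ψ s) y) + inner ℝ (g s y) (ψ s y)) = 0)) ∧ (∀ R : ℝ, 1 ≤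 R → R ≤ L j → ∀ᵐ s : ℝ, s ∈ Set.Icc (-R ^ 2) (R ^ 2) → ∫⁻ y in Metric.ball (0 : EuclideanSpace ℝ (Fin 3)) R, ‖V j s y‖ₑ ^ 2 ≤ ENNReal.ofReal (E R))) → (∃ v : ℝ → EuclideanSpace ℝ (Fin 3) → EuclideanSpace ℝ (Fin 3), (MeasureTheory.AEStronglyMeasurable (Function.uncurry v) MeasureTheory.volume ∧ (∀ R : ℝ, 0 < R → ∃ C : NNReal, ∀ᵐ t : ℝ, t ∈ Set.Icc (-R ^ 2) (R ^ 2) → ∫⁻ x in Metric.ball (0 : EuclideanSpace ℝ (Fin 3)) (R), ‖v t x‖ₑ ^ 2 ≤ C) ∧ (∀ᵐ t : ℝ, Literature.Analysis.FluidPDE.IsWeaklyDivFree (v t)) ∧ (∃ G : ℝ → EuclideanSpace ℝ (Fin 3) → EuclideanSpace ℝ (Fin 3) →L[ℝ] EuclideanSpace ℝ (Fin 3), Literature.Analysis.FluidPDE.HasWeakSpatialGradientOn (Literature.Analysis.FluidPDE.slab (EuclideanSpace ℝ (Fin 3)) Set.univ isOpen_univ) v G ∧ ∀ R : ℝ, 0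 < R → ∫⁻ z in Set.Icc (-R ^ 2) (R ^ 2) ×ˢ Metric.ball (0 : EuclideanSpace ℝ (Fin 3)) (R), ENNReal.ofReal (Literature.Analysis.FluidPDE.frobeniusNormSq (G z.1 z.2)) < ⊤) ∧ (∀ ψ : ℝ → EuclideanSpace ℝ (Fin 3) → EuclideanSpace ℝ (Fin 3), Literature.Analysis.FluidPDE.IsSpaceTimeTestOn (Literature.Analysis.FluidPDE.slab (EuclideanSpace ℝ (Fin 3)) Set.univ isOpen_univ) ψ → (∀ t, Literature.Analysis.FluidPDE.VectorCalculus.IsDivFree (ψ t)) → ∫ t, ∫ x, (inner ℝ (v t x) (Literature.Analysis.FluidPDE.timeDeriv ψ t x) + inner ℝ (v t x) (Literature.Analysis.FluidPDE.convect (v t) (ψ t) x) + inner ℝ (v t x) (Laplacian.laplacian (ψ t) x)) = 0)) ∧ (∃ M' : ℝ, (∀ R : ℝ, 1 ≤ R → ∀ᵐ t : ℝ, t ∈ Set.Icc (-R ^ 2) (R ^ 2) → ∫⁻ x in Metric.ball (0 : EuclideanSpace ℝ (Fin 3)) (R), ‖v t x - ⨍ y in Metric.ball (0 : EuclideanSpace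 ℝ (Fin 3)) (R), v t y‖ₑ ^ 2 ≤ ENNReal.ofReal (M' * R ^ (3 + 2 * h)))) ∧ ((1 : ENNReal) ≤ ∫⁻ t in Set.Icc (-1 : ℝ) 1, ∫⁻ x in Metric.ball (0 : EuclideanSpace ℝ (Fin 3)) (1), ‖v t x - ⨍ y in Metric.ball (0 : EuclideanSpace ℝ (Fin 3)) (1), v t y‖ₑ ^ 2))

end __Registered

/-- **Composition** (kernel-checked, no `sorry` of its own): the three stub statements (as the name-keyed
aliases `__Registered.stub_*`) imply the crux
`Summit.AnomalousDissipation.AnomalousDissipation.Theses.KolmogorovLiouville.KolmogorovBlowup` BY NAME.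
Unpack the crux data `(h, M, D, f, ν, u₀, u, t, ρ, x)` and hypotheses; `C` from stub 1 at `f`; `E` from stub 2;
`L_j := 1/ρ_j → ∞` (from `ρ_j² = (ρ_j²/ν_j)·ν_j → 0`, `ρ_j = √(ρ_j²) → 0` inside `(0, ∞)`, inversion) and
`δ_j := C (ρ_j²/ν_j)² → 0`; stub 3 applied to the local fields
`V_j s y = (ρ_j/ν_j) • (lift (u_j τ) (x_j τ + ρ_j • y) − deriv (x_j) τ)`, `τ = t_j + ρ_j² s/ν_j`, whose stub-3
hypotheses are exactly stub 1 at index `j` (instantiated at `t₀ = t_j`, `ρ = ρ_j`, `ν = ν_j`, the frame clauses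
being the `j`-th components of the crux's frame conjunction) and stub 2 at `j`. [folklore] -/
theorem KolmogorovBlowup_of :
    __Registered.stub_localUnitsCovariance → __Registered.stub_quasiLagrangianEnergy →
      __Registered.stub_compactnessToKolmogorovState →
        Summit.AnomalousDissipation.AnomalousDissipation.Theses.KolmogorovLiouville.KolmogorovBlowup := by
  intro H1 H2 H3
  dsimp only [__Registered.stub_localUnitsCovariance, __Registered.stub_quasiLagrangianEnergy,
    __Registered.stub_compactnessToKolmogorovState] at H1 H2 H3
  intro h M D hh f ν u₀ u t ρ x hf hdiv hmean hν hν0 hLH hF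
  obtain ⟨C, hC⟩ := H1 f hf
  obtain ⟨E, hE⟩ := H2 h M D f ν u₀ u t ρ x hf hdiv hmean hν hν0 hLH hF
  obtain ⟨hρ, hρν, ht, hx, hfloor, hgrowth, hgrad⟩ := hF
  -- `ρ_j² = (ρ_j² / ν_j) · ν_j → 0 · 0`
  have hρ2 : Filter.Tendsto (fun j => ρ j ^ 2) Filter.atTop (nhds 0) := by
    have hmul := hρν.mul hν0
    rw [mul_zero] at hmul
    refine hmul.congr' (Filter.Eventually.of_forall fun j => ?_)
    exact div_mul_cancel₀ (ρ j ^ 2) (hν j).ne'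
  -- `ρ_j = √(ρ_j²) → 0`
  have hρ0 : Filter.Tendsto ρ Filter.atTop (nhds 0) := by
    have hs := hρ2.sqrt
    rw [Real.sqrt_zero] at hs
    refine hs.congr' (Filter.Eventually.of_forall fun j => ?_)
    exact Real.sqrt_sq (hρ j).le
  -- `L_j := 1/ρ_j → ∞`
  have hL : Filter.Tendsto (fun j => 1 / ρ j) Filter.atTop Filter.atTop := by
    have hρ0' : Filter.Tendsto ρ Filter.atTop (nhdsWithin 0 (Set.Ioi 0)) :=
      tendsto_nhdsWithin_iff.2 ⟨hρ0, Filter.Eventually.of_forall fun j => hρ j⟩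
    have hinv := hρ0'.inv_tendsto_nhdsGT_zero
    refine hinv.congr' (Filter.Eventually.of_forall fun j => ?_)
    simp only [Pi.inv_apply, one_div]
  -- `δ_j := C (ρ_j²/ν_j)² → 0`
  have hδ : Filter.Tendsto (fun j => C * (ρ j ^ 2 / ν j) ^ 2) Filter.atTop (nhds 0) := by
    have hp := (hρν.pow 2).const_mul C
    rwa [zero_pow two_ne_zero, mul_zero] at hp
  -- eventually `ρ_j ≤ 1` (only the tail matters to stub 3; stub 1 needs it to keep the floor window in `τ ≥ 0`)
  have hev : ∀ᶠ j in Filter.atTop, ρ j ≤ 1 := Filter.Tendsto.eventually_le_const zero_lt_one hρ0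
  refine H3 h M D E hh
    (fun j s y => (ρ j / ν j) • (Literature.Analysis.FunctionSpaces.Torus.lift (u j (t j + ρ j ^ 2 * s / ν j)) (x j (t j + ρ j ^ 2 * s / ν j) + ρ j • y) - deriv (x j) (t j + ρ j ^ 2 * s / ν j)))
    (fun j => 1 / ρ j) (fun j => C * (ρ j ^ 2 / ν j) ^ 2) hL hδ (hev.mono fun j hj => ⟨?_, ?_⟩)
  · exact hC h M D (ν j) (t j) (ρ j) (u₀ j) (u j) (x j) (hν j) (hρ j) hj (ht j) (hx j) (hLH j) (hfloor j)
      (hgrowth j) (hgrad j) _ (fun s y => rfl)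
  · exact hE j _ (fun s y => rfl)

/-- **The skeleton in its final shape** (D-0027 §3.3): the crux BY NAME from the three registered stubs, through
the sorry-free composition `KolmogorovBlowup_of`; it becomes the crux proof when the last `stub_*` is discharged
(until then it depends on `sorryAx` through the stubs ONLY — no `sorry` of its own). This file lives under
`Cruxes/…/Lines/` (elaborated, never built or imported), so no BC probe can reach this constant by `exact?`;
the BC3 probes of this line import only the route file. -/
theorem KolmogorovBlowup_skeleton :
    Summit.AnomalousDissipation.AnomalousDissipation.Theses.KolmogorovLiouville.KolmogorovBlowup :=
  KolmogorovBlowup_of stub_localUnitsCovariance stub_quasiLagrangianEnergy stub_compactnessToKolmogorovState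

end Summit.AnomalousDissipation.AnomalousDissipation.Cruxes.KolmogorovBlowup.Birth

end
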